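import Mathlib
import HarnessLib
import Summits.HubbardSuperconductivity.HubbardSuperconductivity.Theorems.KLProgrammeKLRegimeTwoVolumeTowerSmallnessGeom

/-!
# Route `KLProgramme` — crux K3, VL child `KLRegimeVolumeLimitV17F2` (stmt-HubbardSuperconductivity-20440), skeleton «cauchy» v11: THE RADII OF THE TOWER AND
# THE SIX RATIOS OF (H3) FROM THE SCALE LAWS (assembler kit for `…TowerSmallnessGeom.towerSmallness_of_geom`; seat hubbard-kl-k3c4-p1 g15; `--supports` 20440)

`towerSmallness_of_geom` asks, per scale `j < J`, for radii `ρ₀ ρf ρ₂ ρ′ ρ₃`, ratios `q τ` and SIX RATIO CONDITIONS `hr₀ hr₅ hr₄ hr₁ hx₁ hy₆` (plus `hτ0`, `hτsucc`).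
With the doors' scale laws — Gram constants `κ′_j ≤ κ_j`, `κ_{j+1} ≤ κ_j` (p3: `κ_j = √(Cκ·16·klE0·8^{−j})`), frame-path Gram constant `κf_j ≤ kf·κ_j`,
transfer row constant `1 ≤ cW_j ≤ cW₀` (p3: one absolute `Cw`), mismatch cap `0 ≤ δb_j ≤ δb₀` — ONE choice closes all six at every scale:
all radii `= κ_j` except the next-state radius `ρ₀_j = r₀·κ_j` with `r₀ ≥ 8e²(kf+1)(cW₀+δb₀+1)`, `q_j = 1/(2(e²(κ_j+ρ₀_j))²)` (ratio `hr₀ = 1/2`, the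
«largest admissible q» of DISCHARGER-GUIDE-g14 §2 / bus 07:51Z «cW-BUDGET»), `τ_0 = q_0`, `τ_{j+1} = ρ₀_j⁻²`.

* **`towerRatios_of_laws`** — signs, `hτ0`, `hτsucc` and the six ratios, in the literal hypothesis shapes of `towerSmallness_of_geom` with
  `ρf = ρ₂ = ρ′ = ρ₃ := κ`.

Proofs only; no definition; elementary real inequalities (`Real.exp 2` enters only through `0 < e²` and the size of `r₀`).
[cite: BenfattoGiulianiMastropietro2006, §2.7 (2.77)-(2.80), §3 (3.2)-(3.8)]
-/

noncomputable section

namespace Summit.HubbardSuperconductivity.HubbardSuperconductivity.Theorems.TwoVolumeSource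

set_option linter.dupNamespace false -- summit = problem name (single-conjunct summit), D-0017

/-- Scale `0` pattern: `(E·S)²·(c²·q) < 1` for `q = 1/(2(E(κ+rκ))²)`, `S ≤ s·κ`, `c ≤ c₀`, `s·c₀ ≤ 1 + r`. [folklore] -/
private theorem ratio_lt_one_zero {E κ S c s c₀ r : ℝ} (hE : 0 < E) (hκ : 0 < κ) (hS0 : 0 ≤ S) (hS : S ≤ s * κ) (hc0 : 0 ≤ c) (hc : c ≤ c₀)
    (hs : 0 ≤ s) (hr : 0 ≤ r) (hsc : s * c₀ ≤ 1 + r) :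
    (E * S) ^ 2 * (c ^ 2 * (1 / (2 * (E * (κ + r * κ)) ^ 2))) < 1 := by
  have hD : 0 < E * (κ + r * κ) := by positivity
  have h1 : E * S * c ≤ E * (κ + r * κ) := by
    have h2 : S * c ≤ s * κ * c₀ := mul_le_mul hS hc hc0 (by positivity)
    have h3 : s * κ * c₀ ≤ (1 + r) * κ := by nlinarith [hκ.le]
    nlinarith [hE.le]
  have h0 : 0 ≤ E * S * c := by positivity
  have h4 : (E * S * c) ^ 2 ≤ (E * (κ + r * κ)) ^ 2 := pow_le_pow_left₀ h0 h1 2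
  have hD2 : 0 < (E * (κ + r * κ)) ^ 2 := by positivity
  calc (E * S) ^ 2 * (c ^ 2 * (1 / (2 * (E * (κ + r * κ)) ^ 2))) = (E * S * c) ^ 2 / (2 * (E * (κ + r * κ)) ^ 2) := by ring
    _ ≤ (E * (κ + r * κ)) ^ 2 / (2 * (E * (κ + r * κ)) ^ 2) := div_le_div_of_nonneg_right h4 (by positivity)
    _ = 1 / 2 := by field_simp
    _ < 1 := by norm_num

/-- Scale `i+1` pattern: `(E·S)²·(c²·(r·κ)⁻²) < 1` for `S ≤ s·κ`, `c ≤ c₀`, `E·s·c₀ < r`. [folklore] -/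
private theorem ratio_lt_one_succ {E κ S c s c₀ r : ℝ} (hE : 0 < E) (hκ : 0 < κ) (hS0 : 0 ≤ S) (hS : S ≤ s * κ) (hc0 : 0 ≤ c) (hc : c ≤ c₀)
    (hs : 0 ≤ s) (hsc : E * s * c₀ < r) :
    (E * S) ^ 2 * (c ^ 2 * (r * κ)⁻¹ ^ 2) < 1 := by
  have hr : 0 < r := lt_of_le_of_lt (mul_nonneg (mul_nonneg hE.le hs) (hc0.trans hc)) hsc
  have h1 : E * S * c < r * κ := by
    have h2 : S * c ≤ s * κ * c₀ := mul_le_mul hS hc hc0 (by positivity)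
    have h3 : E * (s * κ * c₀) < r * κ := by nlinarith [hκ]
    nlinarith [hE.le]
  have h0 : 0 ≤ E * S * c := by positivity
  have h4 : (E * S * c) ^ 2 < (r * κ) ^ 2 := pow_lt_pow_left₀ h1 h0 two_ne_zero
  have hD2 : 0 < (r * κ) ^ 2 := by positivity
  calc (E * S) ^ 2 * (c ^ 2 * (r * κ)⁻¹ ^ 2) = (E * S * c) ^ 2 / (r * κ) ^ 2 := by rw [inv_pow]; ring
    _ < 1 := (div_lt_one hD2).2 h4

/-- **THE RADII AND THE SIX RATIOS OF (H3) FROM THE SCALE LAWS** (see the module docstring). [cite: BenfattoGiulianiMastropietro2006, §2.7 (2.77)-(2.80)] -/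
theorem towerRatios_of_laws (J : ℕ) (κ κ' κf cW δb ρ₀ q τ : ℕ → ℝ) (kf cW₀ δb₀ r₀ : ℝ)
    (hκ : ∀ j, 0 < κ j) (hκ'0 : ∀ j, 0 < κ' j) (hκ' : ∀ j, κ' j ≤ κ j) (hκmono : ∀ j, κ (j + 1) ≤ κ j)
    (hκf0 : ∀ j, 0 < κf j) (hκf : ∀ j, κf j ≤ kf * κ j) (hkf : 1 ≤ kf)
    (hcW1 : ∀ j, 1 ≤ cW j) (hcW : ∀ j, cW j ≤ cW₀) (hδb0 : ∀ j, 0 ≤ δb j) (hδb : ∀ j, δb j ≤ δb₀)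
    (hr₀ : 8 * Real.exp 2 * (kf + 1) * (cW₀ + δb₀ + 1) ≤ r₀)
    -- the choice
    (hρ₀ : ∀ j, ρ₀ j = r₀ * κ j) (hq : ∀ j, q j = 1 / (2 * (Real.exp 2 * (κ j + ρ₀ j)) ^ 2))
    (hτ0 : τ 0 = q 0) (hτs : ∀ j, τ (j + 1) = (ρ₀ j)⁻¹ ^ 2) :
    (∀ j, 0 < ρ₀ j) ∧ (∀ j, 0 ≤ q j) ∧ (∀ j, 0 ≤ τ j) ∧ q 0 ≤ τ 0 ∧ (∀ j, j + 1 < J → (ρ₀ j)⁻¹ ^ 2 ≤ τ (j + 1)) ∧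
      (∀ j, j < J → (Real.exp 2 * (κ j + ρ₀ j)) ^ 2 * q j < 1) ∧
      (∀ j, j < J → (Real.exp 2 * (κ' j + κ j + κ j)) ^ 2 * (ρ₀ j)⁻¹ ^ 2 < 1) ∧
      (∀ j, j < J → (Real.exp 2 * (κ' j + κ j + (κ' j + κ j + (κ' j + κ j)) + κ j)) ^ 2 * (ρ₀ j)⁻¹ ^ 2 < 1) ∧
      (∀ j, j < J → (Real.exp 2 * (κ' j + κ j)) ^ 2 * q j < 1) ∧
      (∀ j, j < J → (Real.exp 2 * (κ' j + κ j)) ^ 2 * (cW j ^ 2 * τ j) < 1) ∧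
      (∀ j, j < J → (Real.exp 2 * (κf j + κ j)) ^ 2 * ((cW j + δb j) ^ 2 * τ j) < 1) := by
  -- sizes
  set E := Real.exp 2 with hEdef
  have hE : 0 < E := Real.exp_pos 2
  have hE1 : 1 ≤ E := Real.one_le_exp (by norm_num)
  have hcW₀ : 1 ≤ cW₀ := (hcW1 0).trans (hcW 0)
  have hδb₀ : 0 ≤ δb₀ := (hδb0 0).trans (hδb 0)
  have hkf1 : 2 ≤ kf + 1 := by linarith
  have hP₂ : cW₀ + δb₀ < cW₀ + δb₀ + 1 := lt_add_one _
  -- consequences of the size of `r₀`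
  have hc5 : E * (kf + 1) * (cW₀ + δb₀) < r₀ :=
    calc E * (kf + 1) * (cW₀ + δb₀) < E * (kf + 1) * (cW₀ + δb₀ + 1) := mul_lt_mul_of_pos_left hP₂ (by positivity)
      _ ≤ 8 * (E * (kf + 1) * (cW₀ + δb₀ + 1)) := le_mul_of_one_le_left (by positivity) (by norm_num)
      _ = 8 * E * (kf + 1) * (cW₀ + δb₀ + 1) := by ring
      _ ≤ r₀ := hr₀
  have hc3 : E * 2 * cW₀ < r₀ :=
    calc E * 2 * cW₀ ≤ E * (kf + 1) * cW₀ := mul_le_mul_of_nonneg_right (mul_le_mul_of_nonneg_left hkf1 hE.le) (zero_le_one.trans hcW₀)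
      _ ≤ E * (kf + 1) * (cW₀ + δb₀) := mul_le_mul_of_nonneg_left (le_add_of_nonneg_right hδb₀) (by positivity)
      _ < r₀ := hc5
  have hc1 : E * 7 * 1 < r₀ :=
    calc E * 7 * 1 < 8 * E := by linarith
      _ ≤ 8 * E * ((kf + 1) * (cW₀ + δb₀ + 1)) := le_mul_of_one_le_right (by positivity) (by nlinarith)
      _ = 8 * E * (kf + 1) * (cW₀ + δb₀ + 1) := by ring
      _ ≤ r₀ := hr₀
  have hc1' : E * 3 * 1 < r₀ := by linarith
  have hc4 : (kf + 1) * (cW₀ + δb₀) ≤ 1 + r₀ := by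
    have h : (kf + 1) * (cW₀ + δb₀) ≤ E * (kf + 1) * (cW₀ + δb₀) := by
      rw [mul_assoc]; exact le_mul_of_one_le_left (by positivity) hE1
    linarith
  have hc2 : 2 * cW₀ ≤ 1 + r₀ := by
    have h : 2 * cW₀ ≤ E * 2 * cW₀ := by rw [mul_assoc]; exact le_mul_of_one_le_left (by positivity) hE1
    linarith
  have hr₀pos : 0 < r₀ := by linarith [hc1]
  have hr₀1 : 1 ≤ r₀ := by nlinarith [hc1, hE1]
  have hρ₀pos : ∀ j, 0 < ρ₀ j := fun j => by rw [hρ₀]; exact mul_pos hr₀pos (hκ j)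
  have hq0 : ∀ j, 0 ≤ q j := fun j => by rw [hq]; positivity
  have hτnn : ∀ j, 0 ≤ τ j := fun j => by
    cases j with
    | zero => rw [hτ0]; exact hq0 0
    | succ i => rw [hτs]; positivity
  -- `q_j·(E(κ_j+ρ₀_j))² = 1/2`
  have hqid : ∀ j, (E * (κ j + ρ₀ j)) ^ 2 * q j = 1 / 2 := fun j => by
    have hne : κ j + ρ₀ j ≠ 0 := by have := hκ j; have := hρ₀pos j; positivity
    rw [hq j]; field_simp
  refine ⟨hρ₀pos, hq0, hτnn, by rw [hτ0], fun j _ => by rw [hτs], fun j _ => by rw [hqid]; norm_num, fun j _ => ?_, fun j _ => ?_, fun j _ => ?_,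
    fun j _ => ?_, fun j _ => ?_⟩
  · -- hr₅: `S = κ'+2κ ≤ 3κ`, `c = 1`, `3E < r₀`
    have h := ratio_lt_one_succ (S := κ' j + κ j + κ j) (c := 1) (c₀ := 1) (s := 3) hE (hκ j) (by have := hκ'0 j; have := hκ j; positivity)
      (by linarith [hκ' j]) zero_le_one le_rfl (by norm_num) hc1'
    rw [hρ₀ j]; simpa using h
  · -- hr₄: `S ≤ 7κ`
    have h := ratio_lt_one_succ (S := κ' j + κ j + (κ' j + κ j + (κ' j + κ j)) + κ j) (c := 1) (c₀ := 1) (s := 7) hE (hκ j)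
      (by have := hκ'0 j; have := hκ j; positivity) (by linarith [hκ' j]) zero_le_one le_rfl (by norm_num) hc1
    rw [hρ₀ j]; simpa using h
  · -- hr₁: `(E(κ'+κ))² q ≤ (E(κ+ρ₀))² q = 1/2`
    have hS : E * (κ' j + κ j) ≤ E * (κ j + ρ₀ j) := by
      refine mul_le_mul_of_nonneg_left ?_ hE.le
      rw [hρ₀ j]
      have : κ j ≤ r₀ * κ j := le_mul_of_one_le_left (hκ j).le hr₀1
      linarith [hκ' j]
    have hS0 : 0 ≤ E * (κ' j + κ j) := by have := hκ'0 j; have := hκ j; positivity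
    calc (E * (κ' j + κ j)) ^ 2 * q j ≤ (E * (κ j + ρ₀ j)) ^ 2 * q j := mul_le_mul_of_nonneg_right (pow_le_pow_left₀ hS0 hS 2) (hq0 j)
      _ = 1 / 2 := hqid j
      _ < 1 := by norm_num
  · -- hx₁
    cases j with
    | zero =>
      rw [hτ0, hq 0, hρ₀ 0]
      exact ratio_lt_one_zero (S := κ' 0 + κ 0) (s := 2) hE (hκ 0) (by have := hκ'0 0; have := hκ 0; positivity) (by linarith [hκ' 0])
        (zero_le_one.trans (hcW1 0)) (hcW 0) (by norm_num) hr₀pos.le hc2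
    | succ i =>
      rw [hτs i, hρ₀ i]
      exact ratio_lt_one_succ (S := κ' (i + 1) + κ (i + 1)) (s := 2) hE (hκ i) (by have := hκ'0 (i + 1); have := hκ (i + 1); positivity)
        (by linarith [hκ' (i + 1), hκmono i]) (zero_le_one.trans (hcW1 (i + 1))) (hcW (i + 1)) (by norm_num) hc3
  · -- hy₆
    have hS : κf j + κ j ≤ (kf + 1) * κ j := by nlinarith [hκf j, hκ j]
    cases j with
    | zero =>
      rw [hτ0, hq 0, hρ₀ 0]
      exact ratio_lt_one_zero (S := κf 0 + κ 0) (s := kf + 1) hE (hκ 0) (by have := hκf0 0; have := hκ 0; positivity) hS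
        (add_nonneg (zero_le_one.trans (hcW1 0)) (hδb0 0)) (add_le_add (hcW 0) (hδb 0)) (by linarith) hr₀pos.le hc4
    | succ i =>
      rw [hτs i, hρ₀ i]
      exact ratio_lt_one_succ (S := κf (i + 1) + κ (i + 1)) (s := kf + 1) hE (hκ i) (by have := hκf0 (i + 1); have := hκ (i + 1); positivity)
        (hS.trans (mul_le_mul_of_nonneg_left (hκmono i) (by linarith))) (add_nonneg (zero_le_one.trans (hcW1 (i + 1))) (hδb0 (i + 1))) (add_le_add (hcW (i + 1)) (hδb (i + 1)))
        (by linarith) hc5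

end Summit.HubbardSuperconductivity.HubbardSuperconductivity.Theorems.TwoVolumeSource

end
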